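import Literature.MathematicalPhysics.QuantumFieldTheory.Balaban1983to89.B13Sqrt27
import Literature.Analysis.Matrix.CoerciveCombesThomas
import Literature.Analysis.Complex.HolomorphicParametricIntegral

/-!
# `Balaban1983to89.B13Sqrt27Accretive` — T. Bałaban, *Renormalization group approach to lattice gauge field theories.
II. Cluster expansions*, Commun. Math. Phys. **116** (1988) 1–22 [Balaban1988RG2Cluster], (2.7) p. 13 with p. 15 «the
general case»: the resolvent family and the square root `(C^{(k)})^{1/2} = (C*Δ_kC)^{−1/2}` AT COMPLEX BACKGROUND — for an
ACCRETIVE finite-range complex kernel (no symmetry, no positive measure): «G̃₃(x) has the same properties as G̃₂» read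
on the resolvent UNIFORMLY in `x ≥ 0`, the (2.7) square root as a definition off the symmetric point, its FULL-RATE
decay, its (2.16)-type difference bound, accretivity by the «perturbative argument», and holomorphy in the background

statement-level skeleton of published theorems with citation tags; proofs where landed; nothing here is a claim about
the Yang–Mills mass gap

PDF held: `paper:balaban1988-cmp116-rg-ii-cluster` (journal page = PDF page + 0); pp. 13, 15, 16 re-read this session
(materialised `p0013.txt`, `p0015.txt`, `p0016.txt` by `lit read paper:balaban1988-cmp116-rg-ii-cluster`).

CITATION HEADER (verbatim).  p. 13 [PDF 13], (2.7) and after: *"(C^{(k)})^{1/2} = (C\*Δ_kC)^{−1/2} =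
(1/π)∫₀^∞ dx x^{−1/2}(xI + C\*Δ_kC)^{−1} … The resolvent (xI + C\*Δ_kC)^{−1} has a representation similar to
(C\*Δ_kC)^{−1}. More exactly, the operator C(xI + C\*Δ_kC)^{−1}C\* is representated by the integral (3.185) [13] with
the additional term −½x‖χ\*(QA + D̄μ(QA))‖² under the exponential function … This term determines a nonnegative,
bounded and almost local operator. The integral yields the representation (3.185) [13], with the operator G̃₂ replaced
by G̃₃(x), which is defined as G̃₂, but with this additional operator. The operator G̃₃(x) has the same properties as
G̃₂, especially it can be expanded into a generalized random walk expansion. This yields an expansion of the integral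
above, hence an expansion of (C^{(k)})^{1/2} also."*  p. 15 [PDF 15]: *"The quadratic forms and covariances in H(Z)
are analytic functions on the space of configurations (U, J) satisfying the conditions I.(i)-(iii) on the domain Z,
with constants α′₀, α′₁ much bigger than α₀, α₁ … We consider it as an analytic function of (U, J) in the space
U^c_{k+1}(X, α₀, α₁), and of the complex parameters σ(Z), τ. This complicates estimates of this expression, because the
operators in it are not symmetric, and the second measure is complex. … For the pair (U, 0) the operators are
symmetric, and the measure is positive, and then the estimates are simpler. The general case is handled by a
perturbative argument."*  p. 16 [PDF 16]: *"In the expression on the right-hand side we replace the operators by the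
corresponding operators with σ(Z) = 0, 𝐔 = U, 𝐉 = 0, and we estimate the error … with matrix elements satisfying
the bound* `|R₁(b, b′)| ≦ (O(1)e^{−⅓δ₀M} + O(α₀ + α₁)) exp(−½δ₀|b₋ − b′₋|)` (2.16) … *a bilinear form −⟨B, R₃X⟩ with
R₃ satisfying (2.16)."*  ([13] = CMP **99** (1985) [Balaban1985BackgroundPropagators], p. 428: *"a positive definite
operator C\*Δ_kC with a lower bound γ₀ > 0"*.)

WHAT IS REPRODUCED (cell `pub-ymgap`, D-0062 Track A, seat `dag-n10-b` g2 = -b FIRST-MISSING-ESTIMATE for node N10;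
the tree's `B13Sqrt27` treats (2.7) for a positive definite REAL SYMMETRIC `T = C*Δ_kC` only and records *"NOT treated:
the complex-symmetric operators C\*Δ_k(σ)C of the general pair (𝐔, 𝐉) (p. 15 'perturbative argument'; GAPS G-B13-05
(b), (c))"*; cell GAPS G-B13-05 (a) asks for *"x-uniform constants"* for the resolvent).  Throughout `T : Matrix n n ℂ`
is a finite complex kernel on an index set carrying an `ℕ`-valued pseudo-metric `dist`, of RANGE ONE
(`T i j ≠ 0 → dist i j ≤ 1`) with absolute off-diagonal row/column sums `≤ h`, and `m`-ACCRETIVE,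
`m·Σ|v_i|² ≤ Re Σ conj(v_i)(Tv)_i` — the complex-background form of [13]'s lower bound `γ₀`.
* §1 `resolvent_decay` — **«G̃₃(x) has the same properties as G̃₂», resolvent reading, x-UNIFORM**: for every real
  `x ≥ 0`, `x·1 + T` is invertible and `‖((x·1 + T)⁻¹)_{ij}‖ ≤ (2/(m + x))·e^{−θ·dist(i,j)}` whenever
  `h(e^θ − 1) ≤ m/2` — the rate `θ` does not see `x`, the amplitude improves with `x` (the tree's accretive
  Combes–Thomas bound `Literature.Analysis.Matrix.accretive_combes_thomas` on the `(m + x)`-accretive shift,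
  `accretive_add_smul_one`); `resolvent_bound_of_accretive` — invertibility and `≤ 2/(m + x)` from accretivity ALONE.
  (By `B13Resolvent27.resolvent_rep_27_restrict` the `Λ̃`-block of G̃₃(x)'s observed covariance IS this resolvent.)
* §2 `invSqrt T := (1/π)∫₀^∞ x^{−1/2}(x·1 + T)⁻¹ dx` — (2.7) as the DEFINITION of the square root off the symmetric
  point (entrywise Bochner integral; `integrableOn_integrand`, continuity of the resolvent in `x`); the amplitude bound
  `norm_invSqrt_apply_le_of_accretive` (`≤ 2/√m`) and **`norm_invSqrt_apply_le`: `‖(T^{−1/2})_{ij}‖ ≤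
  (2/√m)·e^{−θ·dist(i,j)}`** — the SAME rate as the resolvent family (`(1/π)∫₀^∞ x^{−1/2}·2(m + x)⁻¹dx = 2/√m`,
  `B13Sqrt27.integral_kernel_Ioi`), no symmetry, no `ρ < γ`.
* §3 `invSqrt_map_ofReal` — at a positive definite real symmetric `T` (the pair (U, 0)) `invSqrt` IS the
  functional-calculus `T^{−1/2}` of `B13Sqrt27` (`invSqrt_apply_eq_integral`; there `invSqrt_mul_self` certifies
  `T^{−1/2}·T^{−1/2} = T⁻¹ = C^{(k)}`), via `map_inv_ofReal` ∕ `resolvent_map_ofReal`.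
* §4 **`norm_invSqrt_sub_apply_le` — the (2.16)-type bound for the `(C^{(k)})^{1/2}`-factor of R₃, DERIVED**: two such
  kernels `T, T′` with `‖(T − T′)_{kl}‖ ≤ B·e^{−ρ·D(k,l)}` for any non-negative weight `D` dominated through `dist`
  (`D(i,j) ≤ dist(i,k) + D(k,l) + dist(l,j)`: the passage distance through the σ-region, or `dist` itself) have
  `‖(T^{−1/2} − T′^{−1/2})_{ij}‖ ≤ (4B·c_V²/(m√m))·e^{−θ′·D(i,j)}` (`0 ≤ θ′ ≤ ρ`, `θ′ + η ≤ θ`, volume sums `c_V`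
  at rate `η`) — resolvent identity + `norm_mul_mul_apply_le_through`.
* §5 `accretive_of_coercive_add` — p. 15's «perturbative argument» in one line: a `γ`-coercive real reference `T₀`
  plus a complex perturbation `P` with absolute row/column sums `≤ p` is `(γ − p)`-accretive
  (`re_form_map_ofReal`, the Schur bound `abs_re_form_le_of_rowSum_colSum`).
* §6 **`differentiableOn_invSqrt_apply`** — if `u ↦ T(u)` is entrywise complex-differentiable on a ball of a complex
  normed configuration space and uniformly `m`-accretive there, every entry of `u ↦ T(u)^{−1/2}` is
  complex-differentiable on the ball (the tree's `Literature.Analysis.Complex.differentiableOn_integral_of_dominated`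
  with the majorant `2·kernel m`; `differentiableOn_det`, `differentiableOn_inv_apply` = Leibniz ∕ Cramer).
USE (by name).  For the (2.14) Γ-kernel `Γ_k(Z₀,σ,𝐔,𝐉) = C*Δ_k(σ)C_{Z₀^c}(C^{(k)})^{1/2}(σ)` the tree's NODE-O interface
(`NodeOLetters`: letters (L1) decay, (L2) localised difference at the reference, (L3) holomorphy in `u`;
`B13PrimitiveKernels216.differences216_of_analytic`: `hσΓ`, `haΓ`, `hmΓ`) needs exactly §2 ∕ §4 ∕ §6 for the
square-root factor; this file supplies them from the PRECISION operator's accretivity, locality and (2.16)-type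
difference — in the BACKGROUND direction `u` and for those `σ` at which `C*Δ_k(σ)C` stays accretive (a neighbourhood
of the reference by §5).
HONEST SCOPE.  Finite-matrix theorems; nothing of Bałaban's `Δ_k`, `C^{(k)}`, `G̃₂`, `G̃₃` is constructed, and whether
HIS `C*Δ_k(σ,𝐔,𝐉)C` is accretive with k-uniform `(m, h)` is object-level content of the in-edge [13] (cell GAPS
G-B9-10) and of NODE 00's pin.  The σ-POLYDISC direction of (2.16) (`|σ_j| ≤ e^{κ₁}`, smallness `O(1)e^{−⅓δ₀M}` from
generalized random walks THROUGH the σ₀-cubes, p. 13 ∕ [13] Thm 3.10) is NOT treated here and remains the NODE-O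
content typed in `B13TermWalkData` ∕ `B13TermWalkDataOneTorus.ExistsUniformAcrossSmall`; the square `invSqrt T ·
invSqrt T = T⁻¹` is certified only at the symmetric point (§3), not re-proved for accretive `T`.  One `def` (the
printed object (2.7)); no instance, no notation, no `sorry`, no named fact.  NOT continuum, NOT Clay.
-/

noncomputable section

open MeasureTheory Set Filter Topology Finset Metric
open scoped Matrix ComplexConjugate Real

namespace Literature.MathematicalPhysics.QuantumFieldTheory.Balaban1983to89.B13Sqrt27Accretive

open Literature.Analysis.Matrix (accretive_combes_thomas)
open Literature.MathematicalPhysics.QuantumFieldTheory.Balaban1983to89.B13Sqrt27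
  (kernel kernel_nonneg integral_kernel_Ioi integrableOn_kernel_Ioi)

variable {n : Type*} [Fintype n] [DecidableEq n]

/-! ## §1. Accretivity and the resolvent family `x ↦ (x·1 + T)⁻¹`, `x ≥ 0` -/

/-- The resolvent shift: `((x·1 + T)v)_i = x·v_i + (Tv)_i`. [folklore] -/
private theorem smul_one_add_mulVec (T : Matrix n n ℂ) (x : ℂ) (v : n → ℂ) (i : n) :
    ((x • (1 : Matrix n n ℂ) + T) *ᵥ v) i = x * v i + (T *ᵥ v) i := by
  rw [Matrix.add_mulVec, Matrix.smul_mulVec, Matrix.one_mulVec]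
  rfl

/-- **Accretivity is shifted by the spectral parameter**: if `T` is `m`-accretive
(`m Σ|v_i|² ≤ Re Σ conj(v_i)(Tv)_i`) then `x·1 + T` is `(m + x)`-accretive for real `x` — the spectral shift of
(2.7). [cite: Balaban1988RG2Cluster, (2.7) p.13] -/
theorem accretive_add_smul_one {T : Matrix n n ℂ} {m : ℝ}
    (hacc : ∀ v : n → ℂ, m * ∑ i, ‖v i‖ ^ 2 ≤ (∑ i, star (v i) * (T *ᵥ v) i).re) (x : ℝ)
    (v : n → ℂ) :
    (m + x) * ∑ i, ‖v i‖ ^ 2 ≤ (∑ i, star (v i) * (((x : ℂ) • (1 : Matrix n n ℂ) + T) *ᵥ v) i).re := by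
  have hterm : ∀ i, star (v i) * ((x : ℂ) * v i) = (x : ℂ) * ((‖v i‖ : ℂ) ^ 2) := by
    intro i
    rw [mul_left_comm, Complex.star_def, Complex.conj_mul']
  have hsplit : (∑ i, star (v i) * (((x : ℂ) • (1 : Matrix n n ℂ) + T) *ᵥ v) i)
      = (x : ℂ) * ∑ i, ((‖v i‖ : ℂ) ^ 2) + ∑ i, star (v i) * (T *ᵥ v) i := by
    simp only [smul_one_add_mulVec, mul_add, Finset.sum_add_distrib, Finset.mul_sum, hterm]
  rw [hsplit, Complex.add_re]
  have hre : ((x : ℂ) * ∑ i, ((‖v i‖ : ℂ) ^ 2)).re = x * ∑ i, ‖v i‖ ^ 2 := by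
    have hc : (∑ i, ((‖v i‖ : ℂ) ^ 2)) = ((∑ i, ‖v i‖ ^ 2 : ℝ) : ℂ) := by push_cast; rfl
    rw [hc, ← Complex.ofReal_mul, Complex.ofReal_re]
  rw [hre]
  have h := hacc v
  nlinarith [h]

/-- **«G̃₃(x) has the same properties as G̃₂» — the resolvent family of an accretive finite-range kernel is
localised UNIFORMLY in the spectral parameter.**  Let `dist` be an `ℕ`-valued pseudo-metric on the finite index
set, `T : Matrix n n ℂ` of range one (`T i j ≠ 0 → dist i j ≤ 1`) with absolute off-diagonal row/column sums (over
`{dist ≠ 0}`) `≤ h`, and `m`-ACCRETIVE, `m > 0` (no symmetry, no positivity of any measure: the complex operators of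
p. 15).  If `θ ≥ 0` satisfies `h(e^θ − 1) ≤ m/2` then for EVERY real `x ≥ 0` the matrix `x·1 + T` is invertible and
`|((x·1 + T)⁻¹)_{ij}| ≤ (2/(m + x))·e^{−θ·dist(i,j)}` — the rate `θ` does not depend on `x`, the amplitude improves
with `x`.  (Accretive Combes–Thomas, `Literature.Analysis.Matrix.accretive_combes_thomas`, applied to the
`(m + x)`-accretive shift.) [cite: Balaban1988RG2Cluster, (2.7) p.13, p.15] -/
theorem resolvent_decay (dist : n → n → ℕ) (hd0 : ∀ i, dist i i = 0)
    (hds : ∀ i j, dist i j = dist j i) (hdt : ∀ i j k, dist i k ≤ dist i j + dist j k)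
    (T : Matrix n n ℂ) (hrange : ∀ i j, T i j ≠ 0 → dist i j ≤ 1) (h : ℝ)
    (hrow : ∀ i, ∑ j ∈ univ.filter (fun j => dist i j ≠ 0), ‖T i j‖ ≤ h)
    (hcol : ∀ j, ∑ i ∈ univ.filter (fun i => dist i j ≠ 0), ‖T i j‖ ≤ h)
    (m θ : ℝ) (hm : 0 < m) (hθ : 0 ≤ θ)
    (hacc : ∀ v : n → ℂ, m * ∑ i, ‖v i‖ ^ 2 ≤ (∑ i, star (v i) * (T *ᵥ v) i).re)
    (hη : h * (Real.exp θ - 1) ≤ m / 2) {x : ℝ} (hx : 0 ≤ x) :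
    IsUnit ((x : ℂ) • (1 : Matrix n n ℂ) + T).det ∧
      ∀ i j, ‖((x : ℂ) • (1 : Matrix n n ℂ) + T)⁻¹ i j‖ ≤ 2 / (m + x) * Real.exp (-(θ * dist i j)) := by
  set A : Matrix n n ℂ := (x : ℂ) • (1 : Matrix n n ℂ) + T with hA
  have hoff : ∀ i j, dist i j ≠ 0 → A i j = T i j := by
    intro i j hij
    have hne : i ≠ j := fun heq => hij (heq ▸ hd0 i)
    simp [hA, Matrix.one_apply_ne hne]
  have hrangeA : ∀ i j, A i j ≠ 0 → dist i j ≤ 1 := by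
    intro i j hij
    by_cases hd : dist i j = 0
    · rw [hd]; exact zero_le_one
    · exact hrange i j (by rwa [hoff i j hd] at hij)
  have hrowA : ∀ i, ∑ j ∈ univ.filter (fun j => dist i j ≠ 0), ‖A i j‖ ≤ h := fun i =>
    (Finset.sum_congr rfl fun j hj => by rw [hoff i j (Finset.mem_filter.1 hj).2]).trans_le (hrow i)
  have hcolA : ∀ j, ∑ i ∈ univ.filter (fun i => dist i j ≠ 0), ‖A i j‖ ≤ h := fun j =>
    (Finset.sum_congr rfl fun i hi => by rw [hoff i j (Finset.mem_filter.1 hi).2]).trans_le (hcol j)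
  have hmx : 0 < m + x := by linarith
  have hηx : h * (Real.exp θ - 1) ≤ (m + x) / 2 := hη.trans (by linarith)
  exact accretive_combes_thomas dist hd0 hds hdt A hrangeA h hrowA hcolA (m + x) θ hmx hθ
    (accretive_add_smul_one hacc x) hηx

/-- **Invertibility and the resolvent bound from accretivity ALONE**: for an `m`-accretive `T` (`m > 0`) and real
`x ≥ 0`, `x·1 + T` is invertible and `|((x·1 + T)⁻¹)_{ij}| ≤ 2/(m + x)` (the case `θ = 0` of `resolvent_decay` in the
discrete metric — no locality hypothesis is needed for the amplitude). [cite: Balaban1988RG2Cluster, (2.7) p.13, p.15] -/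
theorem resolvent_bound_of_accretive (T : Matrix n n ℂ) {m : ℝ} (hm : 0 < m)
    (hacc : ∀ v : n → ℂ, m * ∑ i, ‖v i‖ ^ 2 ≤ (∑ i, star (v i) * (T *ᵥ v) i).re) {x : ℝ} (hx : 0 ≤ x) :
    IsUnit ((x : ℂ) • (1 : Matrix n n ℂ) + T).det ∧
      ∀ i j, ‖((x : ℂ) • (1 : Matrix n n ℂ) + T)⁻¹ i j‖ ≤ 2 / (m + x) := by
  -- the discrete metric: every matrix has range one in it
  let dist : n → n → ℕ := fun i j => if i = j then 0 else 1
  have hd0 : ∀ i, dist i i = 0 := fun i => by simp [dist]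
  have hds : ∀ i j, dist i j = dist j i := fun i j => by
    by_cases hij : i = j
    · subst hij; rfl
    · simp [dist, hij, Ne.symm hij]
  have hdt : ∀ i j k, dist i k ≤ dist i j + dist j k := fun i j k => by
    by_cases hik : i = k
    · subst hik; simp [dist]
    · by_cases hij : i = j
      · subst hij; simp [dist, hik]
      · have h1 : dist i j = 1 := by simp [dist, hij]
        have h2 : dist i k = 1 := by simp [dist, hik]
        omega
  have hrange : ∀ i j, T i j ≠ 0 → dist i j ≤ 1 := fun i j _ => by
    by_cases hij : i = j <;> simp [dist, hij]
  -- a crude bound for all row and column sums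
  set h : ℝ := ∑ i, ∑ j, ‖T i j‖ with hh
  have hrow : ∀ i, ∑ j ∈ univ.filter (fun j => dist i j ≠ 0), ‖T i j‖ ≤ h := fun i =>
    (Finset.sum_le_sum_of_subset_of_nonneg (Finset.filter_subset _ _) fun j _ _ => norm_nonneg _).trans
      (Finset.single_le_sum (f := fun i => ∑ j, ‖T i j‖) (fun i _ => Finset.sum_nonneg fun j _ => norm_nonneg _)
        (Finset.mem_univ i))
  have hcol : ∀ j, ∑ i ∈ univ.filter (fun i => dist i j ≠ 0), ‖T i j‖ ≤ h := fun j => by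
    refine (Finset.sum_le_sum_of_subset_of_nonneg (Finset.filter_subset _ _) fun i _ _ => norm_nonneg _).trans ?_
    rw [hh, Finset.sum_comm]
    exact Finset.single_le_sum (f := fun j => ∑ i, ‖T i j‖) (fun j _ => Finset.sum_nonneg fun i _ => norm_nonneg _)
      (Finset.mem_univ j)
  have hη : h * (Real.exp 0 - 1) ≤ m / 2 := by rw [Real.exp_zero, sub_self, mul_zero]; linarith
  obtain ⟨hu, hb⟩ := resolvent_decay dist hd0 hds hdt T hrange h hrow hcol m 0 hm le_rfl hacc hη hx
  exact ⟨hu, fun i j => (hb i j).trans_eq (by rw [zero_mul, neg_zero, Real.exp_zero, mul_one])⟩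

/-! ## §2. The resolvent-integral inverse square root (2.7) of an accretive kernel and its full-rate decay -/

/-- **(2.7) as a DEFINITION for the complex (non-symmetric) operators of p. 15**: the resolvent-integral inverse
square root `T^{−1/2} := (1/π)∫₀^∞ dx x^{−1/2}(x·1 + T)⁻¹`, entrywise (a Bochner integral over `(0, ∞)`; for a
positive definite real symmetric `T` it is the functional-calculus `T^{−1/2}` by
`B13Sqrt27.invSqrt_apply_eq_integral`, cf. `invSqrt_map_ofReal` below). [cite: Balaban1988RG2Cluster, (2.7) p.13] -/
def invSqrt (T : Matrix n n ℂ) : Matrix n n ℂ :=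
  Matrix.of fun i j => (π⁻¹ : ℝ) • ∫ x in Ioi (0 : ℝ),
    (Real.sqrt x)⁻¹ • ((x : ℂ) • (1 : Matrix n n ℂ) + T)⁻¹ i j

/-- Unfolding `invSqrt` at an entry. [cite: Balaban1988RG2Cluster, (2.7) p.13] -/
theorem invSqrt_apply (T : Matrix n n ℂ) (i j : n) :
    invSqrt T i j = (π⁻¹ : ℝ) • ∫ x in Ioi (0 : ℝ),
      (Real.sqrt x)⁻¹ • ((x : ℂ) • (1 : Matrix n n ℂ) + T)⁻¹ i j := rfl

/-- Continuity of the resolvent entries in the spectral parameter on a set where `x·1 + T` stays invertible.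
[folklore] -/
private theorem continuousOn_resolvent_apply (T : Matrix n n ℂ) {S : Set ℝ}
    (hS : ∀ x ∈ S, IsUnit ((x : ℂ) • (1 : Matrix n n ℂ) + T).det) (i j : n) :
    ContinuousOn (fun x : ℝ => ((x : ℂ) • (1 : Matrix n n ℂ) + T)⁻¹ i j) S := by
  intro x hx
  have hcont : Continuous fun y : ℝ => (y : ℂ) • (1 : Matrix n n ℂ) + T :=
    (Complex.continuous_ofReal.smul continuous_const).add continuous_const
  obtain ⟨u, hu⟩ := hS x hx
  have hinv : ContinuousAt Inv.inv ((x : ℂ) • (1 : Matrix n n ℂ) + T) :=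
    continuousAt_matrix_inv _ (by rw [← hu]; exact NormedRing.inverse_continuousAt u)
  have h1 : ContinuousAt (fun y : ℝ => ((y : ℂ) • (1 : Matrix n n ℂ) + T)⁻¹) x :=
    ContinuousAt.comp (g := Inv.inv) hinv hcont.continuousAt
  exact (((continuous_apply j).comp (continuous_apply i)).continuousAt.comp h1).continuousWithinAt

/-- The integrand of (2.7) is dominated by `2e^{−θ·dist}·kernel m` under the hypotheses of `resolvent_decay`.
[cite: Balaban1988RG2Cluster, (2.7) p.13] -/
theorem norm_integrand_le {T : Matrix n n ℂ} {m : ℝ} {g : ℝ} {i j : n}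
    (hres : ∀ x : ℝ, 0 ≤ x → ‖((x : ℂ) • (1 : Matrix n n ℂ) + T)⁻¹ i j‖ ≤ 2 / (m + x) * g)
    {x : ℝ} (hx : 0 < x) :
    ‖(Real.sqrt x)⁻¹ • ((x : ℂ) • (1 : Matrix n n ℂ) + T)⁻¹ i j‖ ≤ 2 * g * kernel m x := by
  rw [norm_smul, Real.norm_eq_abs, abs_of_nonneg (inv_nonneg.2 (Real.sqrt_nonneg x)), kernel]
  have h := hres x hx.le
  have hs : 0 ≤ (Real.sqrt x)⁻¹ := inv_nonneg.2 (Real.sqrt_nonneg x)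
  calc (Real.sqrt x)⁻¹ * ‖((x : ℂ) • (1 : Matrix n n ℂ) + T)⁻¹ i j‖
      ≤ (Real.sqrt x)⁻¹ * (2 / (m + x) * g) := mul_le_mul_of_nonneg_left h hs
    _ = 2 * g * ((Real.sqrt x)⁻¹ * (x + m)⁻¹) := by rw [add_comm m x, div_eq_mul_inv]; ring

/-- **Integrability of the (2.7) integrand** for an accretive kernel (`m > 0`): it is continuous on `(0, ∞)` and
dominated by `2·kernel m` (`B13Sqrt27.integrableOn_kernel_Ioi`). [cite: Balaban1988RG2Cluster, (2.7) p.13] -/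
theorem integrableOn_integrand (T : Matrix n n ℂ) {m : ℝ} (hm : 0 < m)
    (hacc : ∀ v : n → ℂ, m * ∑ i, ‖v i‖ ^ 2 ≤ (∑ i, star (v i) * (T *ᵥ v) i).re) (i j : n) :
    IntegrableOn (fun x : ℝ => (Real.sqrt x)⁻¹ • ((x : ℂ) • (1 : Matrix n n ℂ) + T)⁻¹ i j) (Ioi 0) := by
  have hR := fun (x : ℝ) (hx : 0 ≤ x) => resolvent_bound_of_accretive T hm hacc hx
  have hmeas : AEStronglyMeasurable
      (fun x : ℝ => (Real.sqrt x)⁻¹ • ((x : ℂ) • (1 : Matrix n n ℂ) + T)⁻¹ i j)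
      (volume.restrict (Ioi 0)) := by
    refine ContinuousOn.aestronglyMeasurable ?_ measurableSet_Ioi
    have hsq : ContinuousOn (fun x : ℝ => (Real.sqrt x)⁻¹) (Ioi (0 : ℝ)) :=
      ContinuousOn.inv₀ (Real.continuous_sqrt.continuousOn)
        (fun x hx => (Real.sqrt_pos.2 (show (0:ℝ) < x from hx)).ne')
    exact hsq.smul (continuousOn_resolvent_apply T (fun x hx => (hR x (le_of_lt hx)).1) i j)
  refine Integrable.mono' (((integrableOn_kernel_Ioi hm).const_mul (2 * 1))) hmeas ?_
  refine ae_restrict_of_forall_mem measurableSet_Ioi fun x hx => ?_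
  exact norm_integrand_le (fun y hy => ((hR y hy).2 i j).trans_eq (mul_one _).symm) hx

/-- The (2.7) integrand is a.e. strongly measurable on `(0, ∞)` (accretive kernel). [cite: Balaban1988RG2Cluster, (2.7) p.13] -/
theorem aestronglyMeasurable_integrand (T : Matrix n n ℂ) {m : ℝ} (hm : 0 < m)
    (hacc : ∀ v : n → ℂ, m * ∑ i, ‖v i‖ ^ 2 ≤ (∑ i, star (v i) * (T *ᵥ v) i).re) (i j : n) :
    AEStronglyMeasurable (fun x : ℝ => (Real.sqrt x)⁻¹ • ((x : ℂ) • (1 : Matrix n n ℂ) + T)⁻¹ i j)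
      (volume.restrict (Ioi 0)) :=
  (integrableOn_integrand T hm hacc i j).aestronglyMeasurable

/-- **The amplitude bound from accretivity alone**: `|(T^{−1/2})_{ij}| ≤ 2/√m`. [cite: Balaban1988RG2Cluster, (2.7) p.13, p.15] -/
theorem norm_invSqrt_apply_le_of_accretive (T : Matrix n n ℂ) {m : ℝ} (hm : 0 < m)
    (hacc : ∀ v : n → ℂ, m * ∑ i, ‖v i‖ ^ 2 ≤ (∑ i, star (v i) * (T *ᵥ v) i).re) (i j : n) :
    ‖invSqrt T i j‖ ≤ 2 / Real.sqrt m := by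
  have hR := fun (x : ℝ) (hx : 0 ≤ x) => resolvent_bound_of_accretive T hm hacc hx
  have hptw : ∀ x ∈ Ioi (0 : ℝ),
      ‖(Real.sqrt x)⁻¹ • ((x : ℂ) • (1 : Matrix n n ℂ) + T)⁻¹ i j‖ ≤ 2 * 1 * kernel m x :=
    fun x hx => norm_integrand_le (fun y hy => ((hR y hy).2 i j).trans_eq (mul_one _).symm) hx
  have hbound := norm_integral_le_of_norm_le ((integrableOn_kernel_Ioi hm).const_mul (2 * 1))
    (ae_restrict_of_forall_mem measurableSet_Ioi hptw)
  rw [integral_const_mul, integral_kernel_Ioi hm] at hbound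
  rw [invSqrt_apply, norm_smul, Real.norm_eq_abs, abs_of_pos (inv_pos.2 Real.pi_pos)]
  calc π⁻¹ * ‖∫ x in Ioi (0 : ℝ), (Real.sqrt x)⁻¹ • ((x : ℂ) • (1 : Matrix n n ℂ) + T)⁻¹ i j‖
      ≤ π⁻¹ * (2 * 1 * (π / Real.sqrt m)) :=
        mul_le_mul_of_nonneg_left hbound (inv_pos.2 Real.pi_pos).le
    _ = 2 / Real.sqrt m := by
        have hπ0 : (π : ℝ) ≠ 0 := Real.pi_ne_zero
        field_simp

/-- **FULL-RATE DECAY OF THE SQUARE-ROOT KERNEL (2.7) at complex background**: under the hypotheses of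
`resolvent_decay` (accretive `m > 0`, range one, off-diagonal sums `≤ h`, `h(e^θ − 1) ≤ m/2`),
`|(T^{−1/2})_{ij}| ≤ (2/√m)·e^{−θ·dist(i,j)}` — by `(1/π)∫₀^∞ x^{−1/2}·2(m + x)⁻¹ dx = 2/√m`
(`B13Sqrt27.integral_kernel_Ioi`).  No symmetry, no diagonal dominance, and the SAME rate `θ` as the resolvent
family (not half of it). [cite: Balaban1988RG2Cluster, (2.7) p.13, p.15, (2.16) p.16] -/
theorem norm_invSqrt_apply_le (dist : n → n → ℕ) (hd0 : ∀ i, dist i i = 0)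
    (hds : ∀ i j, dist i j = dist j i) (hdt : ∀ i j k, dist i k ≤ dist i j + dist j k)
    (T : Matrix n n ℂ) (hrange : ∀ i j, T i j ≠ 0 → dist i j ≤ 1) (h : ℝ)
    (hrow : ∀ i, ∑ j ∈ univ.filter (fun j => dist i j ≠ 0), ‖T i j‖ ≤ h)
    (hcol : ∀ j, ∑ i ∈ univ.filter (fun i => dist i j ≠ 0), ‖T i j‖ ≤ h)
    (m θ : ℝ) (hm : 0 < m) (hθ : 0 ≤ θ)
    (hacc : ∀ v : n → ℂ, m * ∑ i, ‖v i‖ ^ 2 ≤ (∑ i, star (v i) * (T *ᵥ v) i).re)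
    (hη : h * (Real.exp θ - 1) ≤ m / 2) (i j : n) :
    ‖invSqrt T i j‖ ≤ 2 / Real.sqrt m * Real.exp (-(θ * dist i j)) := by
  have hR := fun (x : ℝ) (hx : 0 ≤ x) =>
    resolvent_decay dist hd0 hds hdt T hrange h hrow hcol m θ hm hθ hacc hη hx
  set g : ℝ := Real.exp (-(θ * dist i j)) with hg
  have hptw : ∀ x ∈ Ioi (0 : ℝ),
      ‖(Real.sqrt x)⁻¹ • ((x : ℂ) • (1 : Matrix n n ℂ) + T)⁻¹ i j‖ ≤ 2 * g * kernel m x :=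
    fun x hx => norm_integrand_le (fun y hy => (hR y hy).2 i j) hx
  have hbound := norm_integral_le_of_norm_le ((integrableOn_kernel_Ioi hm).const_mul (2 * g))
    (ae_restrict_of_forall_mem measurableSet_Ioi hptw)
  rw [integral_const_mul, integral_kernel_Ioi hm] at hbound
  rw [invSqrt_apply, norm_smul, Real.norm_eq_abs, abs_of_pos (inv_pos.2 Real.pi_pos)]
  calc π⁻¹ * ‖∫ x in Ioi (0 : ℝ), (Real.sqrt x)⁻¹ • ((x : ℂ) • (1 : Matrix n n ℂ) + T)⁻¹ i j‖
      ≤ π⁻¹ * (2 * g * (π / Real.sqrt m)) :=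
        mul_le_mul_of_nonneg_left hbound (inv_pos.2 Real.pi_pos).le
    _ = 2 / Real.sqrt m * g := by
        have hπ0 : (π : ℝ) ≠ 0 := Real.pi_ne_zero
        field_simp


/-! ## §3. Consistency with the symmetric case (U, 0): the object IS the functional-calculus `T^{−1/2}` there -/

/-- Inversion commutes with the real-to-complex entry map. [folklore] -/
private theorem map_inv_ofReal (A : Matrix n n ℝ) :
    (A.map (algebraMap ℝ ℂ))⁻¹ = A⁻¹.map (algebraMap ℝ ℂ) := by
  rw [Matrix.inv_def, Matrix.inv_def, Ring.inverse_eq_inv, Ring.inverse_eq_inv]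
  have hdet : (A.map (algebraMap ℝ ℂ)).det = algebraMap ℝ ℂ A.det := by
    rw [RingHom.map_det]; rfl
  have hadj : (A.map (algebraMap ℝ ℂ)).adjugate = A.adjugate.map (algebraMap ℝ ℂ) := by
    have h := RingHom.map_adjugate (algebraMap ℝ ℂ) A
    rw [RingHom.mapMatrix_apply, RingHom.mapMatrix_apply] at h
    exact h.symm
  rw [hdet, hadj, ← map_inv₀]
  ext i j
  simp [Matrix.map_apply, Matrix.smul_apply]

/-- The complexified resolvent of a real matrix is the complexification of its real resolvent (the pair (U, 0):
*"the operators are symmetric"*). [cite: Balaban1988RG2Cluster, p.15, (2.7) p.13] -/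
theorem resolvent_map_ofReal (T : Matrix n n ℝ) (x : ℝ) :
    ((x : ℂ) • (1 : Matrix n n ℂ) + T.map (algebraMap ℝ ℂ))⁻¹
      = (x • (1 : Matrix n n ℝ) + T)⁻¹.map (algebraMap ℝ ℂ) := by
  rw [← map_inv_ofReal]
  congr 1
  ext i j
  by_cases hij : i = j
  · subst hij; simp [Matrix.map_apply, Matrix.one_apply_eq]
  · simp [Matrix.map_apply, Matrix.one_apply_ne hij]

/-- **At a positive definite real symmetric `T` (print p. 15: *"For the pair (U, 0) the operators are symmetric, and
the measure is positive"*) the resolvent-integral object `invSqrt` IS the functional-calculus inverse square root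
of `B13Sqrt27`** (whose `invSqrt_mul_self` certifies `T^{−1/2}·T^{−1/2} = T⁻¹ = C^{(k)}`): the complex definition
extends Bałaban's `(C^{(k)})^{1/2}` off the symmetric point. [cite: Balaban1988RG2Cluster, (2.7) p.13, p.15] -/
theorem invSqrt_map_ofReal {T : Matrix n n ℝ} (hT : T.PosDef) :
    invSqrt (T.map (algebraMap ℝ ℂ)) = (cfc (fun t : ℝ => (Real.sqrt t)⁻¹) T).map (algebraMap ℝ ℂ) := by
  ext i j
  rw [invSqrt_apply, Matrix.map_apply, B13Sqrt27.invSqrt_apply_eq_integral hT i j]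
  have hint : ∀ x : ℝ, (Real.sqrt x)⁻¹ • ((x : ℂ) • (1 : Matrix n n ℂ) + T.map (algebraMap ℝ ℂ))⁻¹ i j
      = (((Real.sqrt x)⁻¹ * (x • (1 : Matrix n n ℝ) + T)⁻¹ i j : ℝ) : ℂ) := by
    intro x
    rw [resolvent_map_ofReal, Matrix.map_apply, Complex.coe_algebraMap, Complex.ofReal_mul,
      Complex.real_smul]
  have h2 : (∫ x in Ioi (0 : ℝ), (((Real.sqrt x)⁻¹ * (x • (1 : Matrix n n ℝ) + T)⁻¹ i j : ℝ) : ℂ))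
      = ((∫ x in Ioi (0 : ℝ), (Real.sqrt x)⁻¹ * (x • (1 : Matrix n n ℝ) + T)⁻¹ i j : ℝ) : ℂ) :=
    integral_ofReal
  rw [setIntegral_congr_fun measurableSet_Ioi (fun x _ => hint x), h2, Complex.real_smul,
    ← Complex.ofReal_mul]
  rfl

/-! ## §4. The (2.16)-type difference bound for the square root: localisation THROUGH a weight `D` transported -/

omit [DecidableEq n] in
/-- **Triple products localise through the middle factor.**  If `‖R_{ik}‖ ≤ a·e^{−θ·dist(i,k)}`,
`‖E_{kl}‖ ≤ B·e^{−ρ·D(k,l)}`, `‖R′_{lj}‖ ≤ a′·e^{−θ·dist(l,j)}` with a non-negative weight `D` dominated through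
`dist` (`D(i,j) ≤ dist(i,k) + D(k,l) + dist(l,j)` — e.g. the passage distance through the σ-region `X`), the volume
sums `Σ_k e^{−η·dist(i,k)} ≤ c_V` (rows and columns), and `0 ≤ θ′ ≤ ρ`, `θ′ + η ≤ θ`, then
`‖(R·E·R′)_{ij}‖ ≤ a·B·a′·c_V²·e^{−θ′·D(i,j)}` — the localisation mechanism behind *"R₃ satisfying (2.16)"*.
[cite: Balaban1988RG2Cluster, (2.16) p.16] -/
theorem norm_mul_mul_apply_le_through (dist : n → n → ℕ) (D : n → n → ℝ) (hD0 : ∀ k l, 0 ≤ D k l)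
    (hD : ∀ i k l j, D i j ≤ dist i k + D k l + dist l j)
    {R E R' : Matrix n n ℂ} {a B a' θ ρ η θ' cV : ℝ} (ha : 0 ≤ a) (hB : 0 ≤ B) (ha' : 0 ≤ a')
    (hθ' : 0 ≤ θ') (hθρ : θ' ≤ ρ) (hθη : θ' + η ≤ θ)
    (hR : ∀ i k, ‖R i k‖ ≤ a * Real.exp (-(θ * dist i k)))
    (hE : ∀ k l, ‖E k l‖ ≤ B * Real.exp (-(ρ * D k l)))
    (hR' : ∀ l j, ‖R' l j‖ ≤ a' * Real.exp (-(θ * dist l j)))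
    (hvol : ∀ i, ∑ k, Real.exp (-(η * dist i k)) ≤ cV) (hvol' : ∀ j, ∑ l, Real.exp (-(η * dist l j)) ≤ cV)
    (i j : n) :
    ‖(R * E * R') i j‖ ≤ a * B * a' * cV ^ 2 * Real.exp (-(θ' * D i j)) := by
  have hcV : 0 ≤ cV := (Finset.sum_nonneg fun k _ => (Real.exp_pos _).le).trans (hvol i)
  -- pointwise bound of one summand
  have hterm : ∀ k l, ‖R i k‖ * ‖E k l‖ * ‖R' l j‖ ≤
      a * B * a' * Real.exp (-(θ' * D i j)) * (Real.exp (-(η * dist i k)) * Real.exp (-(η * dist l j))) := by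
    intro k l
    have h1 : Real.exp (-(θ * dist i k)) ≤ Real.exp (-(θ' * dist i k)) * Real.exp (-(η * dist i k)) := by
      rw [← Real.exp_add]; apply Real.exp_le_exp.2
      have : (0 : ℝ) ≤ dist i k := Nat.cast_nonneg _
      nlinarith
    have h2 : Real.exp (-(ρ * D k l)) ≤ Real.exp (-(θ' * D k l)) :=
      Real.exp_le_exp.2 (neg_le_neg (mul_le_mul_of_nonneg_right hθρ (hD0 k l)))
    have h3 : Real.exp (-(θ * dist l j)) ≤ Real.exp (-(θ' * dist l j)) * Real.exp (-(η * dist l j)) := by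
      rw [← Real.exp_add]; apply Real.exp_le_exp.2
      have : (0 : ℝ) ≤ dist l j := Nat.cast_nonneg _
      nlinarith
    have h4 : Real.exp (-(θ' * dist i k)) * Real.exp (-(θ' * D k l)) * Real.exp (-(θ' * dist l j))
        ≤ Real.exp (-(θ' * D i j)) := by
      rw [← Real.exp_add, ← Real.exp_add]; apply Real.exp_le_exp.2
      have := hD i k l j
      nlinarith
    calc ‖R i k‖ * ‖E k l‖ * ‖R' l j‖
        ≤ (a * Real.exp (-(θ * dist i k))) * (B * Real.exp (-(ρ * D k l))) * (a' * Real.exp (-(θ * dist l j))) :=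
          mul_le_mul (mul_le_mul (hR i k) (hE k l) (norm_nonneg _) (by positivity)) (hR' l j) (norm_nonneg _)
            (by positivity)
      _ ≤ (a * (Real.exp (-(θ' * dist i k)) * Real.exp (-(η * dist i k)))) * (B * Real.exp (-(θ' * D k l)))
            * (a' * (Real.exp (-(θ' * dist l j)) * Real.exp (-(η * dist l j)))) :=
          mul_le_mul (mul_le_mul (mul_le_mul_of_nonneg_left h1 ha) (mul_le_mul_of_nonneg_left h2 hB)
            (by positivity) (by positivity)) (mul_le_mul_of_nonneg_left h3 ha') (by positivity) (by positivity)
      _ = a * B * a' * (Real.exp (-(θ' * dist i k)) * Real.exp (-(θ' * D k l)) * Real.exp (-(θ' * dist l j)))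
            * (Real.exp (-(η * dist i k)) * Real.exp (-(η * dist l j))) := by ring
      _ ≤ a * B * a' * Real.exp (-(θ' * D i j)) * (Real.exp (-(η * dist i k)) * Real.exp (-(η * dist l j))) :=
          mul_le_mul_of_nonneg_right (mul_le_mul_of_nonneg_left h4 (by positivity)) (by positivity)
  -- sum
  calc ‖(R * E * R') i j‖ = ‖∑ l, (∑ k, R i k * E k l) * R' l j‖ := by
        simp only [Matrix.mul_apply, Finset.sum_mul]
    _ ≤ ∑ l, ∑ k, ‖R i k‖ * ‖E k l‖ * ‖R' l j‖ := by
        refine (norm_sum_le _ _).trans (Finset.sum_le_sum fun l _ => ?_)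
        rw [Finset.sum_mul]
        refine (norm_sum_le _ _).trans (Finset.sum_le_sum fun k _ => ?_)
        rw [norm_mul, norm_mul]
    _ ≤ ∑ l, ∑ k, a * B * a' * Real.exp (-(θ' * D i j)) *
          (Real.exp (-(η * dist i k)) * Real.exp (-(η * dist l j))) :=
        Finset.sum_le_sum fun l _ => Finset.sum_le_sum fun k _ => hterm k l
    _ = a * B * a' * Real.exp (-(θ' * D i j)) *
          ((∑ k, Real.exp (-(η * dist i k))) * ∑ l, Real.exp (-(η * dist l j))) := by
        rw [Finset.sum_mul_sum, Finset.sum_comm, Finset.mul_sum]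
        refine Finset.sum_congr rfl fun l _ => ?_
        rw [Finset.mul_sum]
    _ ≤ a * B * a' * Real.exp (-(θ' * D i j)) * (cV * cV) :=
        mul_le_mul_of_nonneg_left (mul_le_mul (hvol i) (hvol' j)
          (Finset.sum_nonneg fun l _ => (Real.exp_pos _).le) hcV) (by positivity)
    _ = a * B * a' * cV ^ 2 * Real.exp (-(θ' * D i j)) := by ring

/-- **THE (2.16)-TYPE DIFFERENCE OF TWO SQUARE ROOTS** (the `(C^{(k)})^{1/2}`-factor's share of R₃ ∕ of
`Differences216`, DERIVED from the precision operators' difference): two kernels `T, T′` both as in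
`resolvent_decay` (same `dist`, `h`, `m`, `θ`) whose difference is localised through the weight `D`,
`‖(T − T′)_{kl}‖ ≤ B·e^{−ρ·D(k,l)}` (print: the σ-part «O(1)e^{−⅓δ₀M}» through the σ-region, or the
background part «O(α₀ + α₁)»), have square roots differing by at most
`(4B·c_V²/(m√m))·e^{−θ′·D(i,j)}` (`0 ≤ θ′ ≤ ρ`, `θ′ + η ≤ θ`, volume sums `c_V` at rate `η`) — resolvent identity
`(x+T)⁻¹ − (x+T′)⁻¹ = (x+T)⁻¹(T′ − T)(x+T′)⁻¹`, §4's triple bound with `(2/(m+x))² ≤ (2/(m+x))(2/m)`, and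
`∫₀^∞ x^{−1/2}(m+x)⁻¹dx = π/√m`. [cite: Balaban1988RG2Cluster, (2.16) p.16, (2.7) p.13, p.15] -/
theorem norm_invSqrt_sub_apply_le (dist : n → n → ℕ) (hd0 : ∀ i, dist i i = 0)
    (hds : ∀ i j, dist i j = dist j i) (hdt : ∀ i j k, dist i k ≤ dist i j + dist j k)
    (T T' : Matrix n n ℂ) (hrange : ∀ i j, T i j ≠ 0 → dist i j ≤ 1)
    (hrange' : ∀ i j, T' i j ≠ 0 → dist i j ≤ 1) (h : ℝ)
    (hrow : ∀ i, ∑ j ∈ univ.filter (fun j => dist i j ≠ 0), ‖T i j‖ ≤ h)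
    (hcol : ∀ j, ∑ i ∈ univ.filter (fun i => dist i j ≠ 0), ‖T i j‖ ≤ h)
    (hrow' : ∀ i, ∑ j ∈ univ.filter (fun j => dist i j ≠ 0), ‖T' i j‖ ≤ h)
    (hcol' : ∀ j, ∑ i ∈ univ.filter (fun i => dist i j ≠ 0), ‖T' i j‖ ≤ h)
    (m θ : ℝ) (hm : 0 < m) (hθ : 0 ≤ θ)
    (hacc : ∀ v : n → ℂ, m * ∑ i, ‖v i‖ ^ 2 ≤ (∑ i, star (v i) * (T *ᵥ v) i).re)
    (hacc' : ∀ v : n → ℂ, m * ∑ i, ‖v i‖ ^ 2 ≤ (∑ i, star (v i) * (T' *ᵥ v) i).re)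
    (hη : h * (Real.exp θ - 1) ≤ m / 2)
    (D : n → n → ℝ) (hD0 : ∀ k l, 0 ≤ D k l) (hD : ∀ i k l j, D i j ≤ dist i k + D k l + dist l j)
    {B ρ η θ' cV : ℝ} (hB : 0 ≤ B) (hθ' : 0 ≤ θ') (hθρ : θ' ≤ ρ) (hθη : θ' + η ≤ θ)
    (hE : ∀ k l, ‖(T - T') k l‖ ≤ B * Real.exp (-(ρ * D k l)))
    (hvol : ∀ i, ∑ k, Real.exp (-(η * dist i k)) ≤ cV) (hvol' : ∀ j, ∑ l, Real.exp (-(η * dist l j)) ≤ cV)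
    (i j : n) :
    ‖(invSqrt T - invSqrt T') i j‖ ≤ 4 * B * cV ^ 2 / (m * Real.sqrt m) * Real.exp (-(θ' * D i j)) := by
  have hR := fun (x : ℝ) (hx : 0 ≤ x) =>
    resolvent_decay dist hd0 hds hdt T hrange h hrow hcol m θ hm hθ hacc hη hx
  have hR' := fun (x : ℝ) (hx : 0 ≤ x) =>
    resolvent_decay dist hd0 hds hdt T' hrange' h hrow' hcol' m θ hm hθ hacc' hη hx
  have hI := integrableOn_integrand T hm hacc i j
  have hI' := integrableOn_integrand T' hm hacc' i j
  set g : ℝ := Real.exp (-(θ' * D i j)) with hg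
  -- the pointwise bound of the difference of the integrands
  have hptw : ∀ x ∈ Ioi (0 : ℝ),
      ‖(Real.sqrt x)⁻¹ • ((x : ℂ) • (1 : Matrix n n ℂ) + T)⁻¹ i j
        - (Real.sqrt x)⁻¹ • ((x : ℂ) • (1 : Matrix n n ℂ) + T')⁻¹ i j‖
        ≤ 4 * B * cV ^ 2 / m * g * kernel m x := by
    intro x hx
    have hx0 : (0 : ℝ) < x := hx
    have hu : IsUnit ((x : ℂ) • (1 : Matrix n n ℂ) + T) :=
      (Matrix.isUnit_iff_isUnit_det _).2 (hR x hx0.le).1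
    have hu' : IsUnit ((x : ℂ) • (1 : Matrix n n ℂ) + T') :=
      (Matrix.isUnit_iff_isUnit_det _).2 (hR' x hx0.le).1
    have hdiff : ((x : ℂ) • (1 : Matrix n n ℂ) + T)⁻¹ - ((x : ℂ) • (1 : Matrix n n ℂ) + T')⁻¹
        = ((x : ℂ) • (1 : Matrix n n ℂ) + T)⁻¹ * (T' - T) * ((x : ℂ) • (1 : Matrix n n ℂ) + T')⁻¹ := by
      rw [Matrix.inv_sub_inv (iff_of_true hu hu')]
      congr 2
      abel
    have hE' : ∀ k l, ‖(T' - T) k l‖ ≤ B * Real.exp (-(ρ * D k l)) := fun k l => by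
      rw [← norm_neg, ← Matrix.neg_apply, neg_sub]; exact hE k l
    have hmx : 0 < m + x := by linarith
    have htriple := norm_mul_mul_apply_le_through dist D hD0 hD (by positivity) hB (by positivity) hθ' hθρ hθη
      (hR x hx0.le).2 hE' (hR' x hx0.le).2 hvol hvol' i j
    rw [← smul_sub, ← Matrix.sub_apply, hdiff, norm_smul, Real.norm_eq_abs,
      abs_of_nonneg (inv_nonneg.2 (Real.sqrt_nonneg x)), kernel]
    have hs : 0 ≤ (Real.sqrt x)⁻¹ := inv_nonneg.2 (Real.sqrt_nonneg x)
    have hcV : 0 ≤ cV := (Finset.sum_nonneg fun k _ => (Real.exp_pos _).le).trans (hvol i)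
    calc (Real.sqrt x)⁻¹ * ‖(((x : ℂ) • (1 : Matrix n n ℂ) + T)⁻¹ * (T' - T) *
            ((x : ℂ) • (1 : Matrix n n ℂ) + T')⁻¹) i j‖
        ≤ (Real.sqrt x)⁻¹ * (2 / (m + x) * B * (2 / (m + x)) * cV ^ 2 * g) :=
          mul_le_mul_of_nonneg_left htriple hs
      _ ≤ (Real.sqrt x)⁻¹ * (2 / (m + x) * B * (2 / m) * cV ^ 2 * g) := by
          gcongr
          linarith
      _ = 4 * B * cV ^ 2 / m * g * ((Real.sqrt x)⁻¹ * (x + m)⁻¹) := by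
          rw [add_comm m x]; field_simp; ring
  have hbound := norm_integral_le_of_norm_le
    ((integrableOn_kernel_Ioi hm).const_mul (4 * B * cV ^ 2 / m * g))
    (ae_restrict_of_forall_mem measurableSet_Ioi hptw)
  rw [integral_const_mul, integral_kernel_Ioi hm] at hbound
  rw [Matrix.sub_apply, invSqrt_apply, invSqrt_apply, ← smul_sub, ← integral_sub hI hI', norm_smul,
    Real.norm_eq_abs, abs_of_pos (inv_pos.2 Real.pi_pos)]
  calc π⁻¹ * ‖∫ x in Ioi (0 : ℝ), ((Real.sqrt x)⁻¹ • ((x : ℂ) • (1 : Matrix n n ℂ) + T)⁻¹ i j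
          - (Real.sqrt x)⁻¹ • ((x : ℂ) • (1 : Matrix n n ℂ) + T')⁻¹ i j)‖
      ≤ π⁻¹ * (4 * B * cV ^ 2 / m * g * (π / Real.sqrt m)) :=
        mul_le_mul_of_nonneg_left hbound (inv_pos.2 Real.pi_pos).le
    _ = 4 * B * cV ^ 2 / (m * Real.sqrt m) * g := by
        have hπ0 : (π : ℝ) ≠ 0 := Real.pi_ne_zero
        have hm0 : m ≠ 0 := hm.ne'
        have hsm : Real.sqrt m ≠ 0 := (Real.sqrt_pos.2 hm).ne'
        field_simp

/-! ## §5. Accretivity at complex background from the symmetric reference (U, 0): «a perturbative argument» -/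

omit [DecidableEq n] in
/-- **Real part of the form of a complexified real matrix**: `Re Σ conj(v_i)(T₀v)_i = ⟨Re v, T₀ Re v⟩ + ⟨Im v, T₀ Im v⟩`
(the cross terms are purely imaginary; no symmetry of `T₀` needed). [folklore] -/
private theorem re_form_map_ofReal (T₀ : Matrix n n ℝ) (v : n → ℂ) :
    (∑ i, star (v i) * ((T₀.map (algebraMap ℝ ℂ)) *ᵥ v) i).re
      = (fun i => (v i).re) ⬝ᵥ (T₀ *ᵥ fun i => (v i).re)
        + (fun i => (v i).im) ⬝ᵥ (T₀ *ᵥ fun i => (v i).im) := by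
  simp only [Matrix.mulVec, dotProduct, Matrix.map_apply, Complex.re_sum, Complex.mul_re,
    Complex.star_def, Complex.conj_re, Complex.conj_im, Finset.mul_sum, ← Finset.sum_add_distrib]
  refine Finset.sum_congr rfl fun i _ => Finset.sum_congr rfl fun j _ => ?_
  simp only [Complex.mul_im, Algebra.algebraMap_eq_smul_one, Complex.real_smul, mul_one,
    Complex.ofReal_re, Complex.ofReal_im, zero_mul, sub_zero, add_zero]
  ring

omit [DecidableEq n] in
/-- **Schur bound for the perturbation**: if the absolute row and column sums of `P` are `≤ p` then
`|Re Σ conj(v_i)(Pv)_i| ≤ p·Σ|v_i|²`. [folklore] -/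
private theorem abs_re_form_le_of_rowSum_colSum (P : Matrix n n ℂ) {p : ℝ} (hp : 0 ≤ p)
    (hrow : ∀ i, ∑ j, ‖P i j‖ ≤ p) (hcol : ∀ j, ∑ i, ‖P i j‖ ≤ p) (v : n → ℂ) :
    |(∑ i, star (v i) * (P *ᵥ v) i).re| ≤ p * ∑ i, ‖v i‖ ^ 2 := by
  set S : ℝ := ∑ i, ‖v i‖ ^ 2 with hS
  have hS0 : 0 ≤ S := Finset.sum_nonneg fun i _ => by positivity
  have h1 : |(∑ i, star (v i) * (P *ᵥ v) i).re| ≤ ‖star v ⬝ᵥ (P *ᵥ v)‖ :=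
    (Complex.abs_re_le_norm _).trans_eq rfl
  have h2 := Literature.Analysis.Matrix.norm_star_dotProduct_le_sqrt_mul_sqrt v (P *ᵥ v)
  have h3 := Literature.Analysis.Matrix.sum_norm_sq_mulVec_le_of_rowSum_le_of_colSum_le P hp hrow hcol v
  have h4 : Real.sqrt (∑ i, ‖(P *ᵥ v) i‖ ^ 2) ≤ p * Real.sqrt S := by
    rw [← Real.sqrt_sq hp, ← Real.sqrt_mul (sq_nonneg p)]
    exact Real.sqrt_le_sqrt (by nlinarith [h3])
  calc |(∑ i, star (v i) * (P *ᵥ v) i).re| ≤ Real.sqrt S * Real.sqrt (∑ i, ‖(P *ᵥ v) i‖ ^ 2) := h1.trans h2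
    _ ≤ Real.sqrt S * (p * Real.sqrt S) := mul_le_mul_of_nonneg_left h4 (Real.sqrt_nonneg _)
    _ = p * S := by rw [mul_left_comm, Real.mul_self_sqrt hS0]

omit [DecidableEq n] in
/-- The squared norms split into real and imaginary parts: `Σ|v_i|² = Σ(Re v_i)² + Σ(Im v_i)²`. [folklore] -/
private theorem sum_norm_sq_eq_re_im (v : n → ℂ) :
    ∑ i, ‖v i‖ ^ 2 = (fun i => (v i).re) ⬝ᵥ (fun i => (v i).re) + (fun i => (v i).im) ⬝ᵥ (fun i => (v i).im) := by
  simp only [dotProduct, ← Finset.sum_add_distrib]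
  refine Finset.sum_congr rfl fun i _ => ?_
  rw [Complex.sq_norm, Complex.normSq_apply]

omit [DecidableEq n] in
/-- **ACCRETIVITY AT COMPLEX BACKGROUND** (print p. 15: *"For the pair (U, 0) the operators are symmetric, and the
measure is positive … The general case is handled by a perturbative argument"*): if the reference precision `T₀`
(real, e.g. `C*Δ_kC` at `(U, 0)` with its lower bound `γ₀` of [13] p. 428) is `γ`-coercive and the complex
perturbation `P = T − T₀` (print: the (2.16)-type difference, entrywise `≤ θ_E·e^{−κd}`) has absolute row and column
sums `≤ p`, then `T = T₀ + P` is `(γ − p)`-accretive — the hypothesis `hacc` of §§1–4 with `m = γ − p`.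
[cite: Balaban1988RG2Cluster, p.15, (2.16) p.16] -/
theorem accretive_of_coercive_add {T₀ : Matrix n n ℝ} {γ p : ℝ} (hc : QGQInverse.Coercive T₀ γ)
    {P : Matrix n n ℂ} (hp : 0 ≤ p) (hrow : ∀ i, ∑ j, ‖P i j‖ ≤ p) (hcol : ∀ j, ∑ i, ‖P i j‖ ≤ p)
    (v : n → ℂ) :
    (γ - p) * ∑ i, ‖v i‖ ^ 2 ≤ (∑ i, star (v i) * ((T₀.map (algebraMap ℝ ℂ) + P) *ᵥ v) i).re := by
  have hsplit : (∑ i, star (v i) * ((T₀.map (algebraMap ℝ ℂ) + P) *ᵥ v) i)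
      = (∑ i, star (v i) * ((T₀.map (algebraMap ℝ ℂ)) *ᵥ v) i) + ∑ i, star (v i) * (P *ᵥ v) i := by
    simp only [Matrix.add_mulVec, Pi.add_apply, mul_add, Finset.sum_add_distrib]
  rw [hsplit, Complex.add_re, re_form_map_ofReal]
  have h0 := hc (fun i => (v i).re)
  have h1 := hc (fun i => (v i).im)
  have h2 := abs_re_form_le_of_rowSum_colSum P hp hrow hcol v
  have h3 := sum_norm_sq_eq_re_im v
  have h4 := neg_le_of_abs_le h2
  have h5 : γ * ∑ i, ‖v i‖ ^ 2 = γ * ((fun i => (v i).re) ⬝ᵥ (fun i => (v i).re))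
      + γ * ((fun i => (v i).im) ⬝ᵥ (fun i => (v i).im)) := by rw [h3, mul_add]
  have h6 : (γ - p) * ∑ i, ‖v i‖ ^ 2 = γ * ∑ i, ‖v i‖ ^ 2 - p * ∑ i, ‖v i‖ ^ 2 := by ring
  linarith [h0, h1, h4, h5, h6]


/-! ## §6. Analyticity in the background: the square root of a holomorphic accretive family is holomorphic -/

section Analytic

variable {E : Type*} [NormedAddCommGroup E] [NormedSpace ℂ E]

/-- Entrywise-holomorphic matrix families have holomorphic determinants (Leibniz formula) — the elementary half of
p. 15's *"analytic functions on the space of configurations (U, J)"* for finite kernels. [cite: Balaban1988RG2Cluster, p.15] -/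
theorem differentiableOn_det {A : E → Matrix n n ℂ} {s : Set E}
    (hA : ∀ i j, DifferentiableOn ℂ (fun u => A u i j) s) :
    DifferentiableOn ℂ (fun u => (A u).det) s := by
  simp only [Matrix.det_apply']
  refine DifferentiableOn.fun_sum fun σ _ => DifferentiableOn.const_mul ?_ _
  intro x hx
  have h := HasFDerivWithinAt.finsetProd (u := (Finset.univ : Finset n))
    (g := fun i u => A u (σ i) i) (fun i _ => ((hA (σ i) i) x hx).hasFDerivWithinAt)
  exact h.differentiableWithinAt

/-- **Entries of the inverse of an entrywise-holomorphic, pointwise-invertible matrix family are holomorphic**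
(Cramer: `A⁻¹ = (det A)⁻¹·adj A`, the adjugate entries being determinants) — covariances of holomorphic precision
families are holomorphic, p. 15. [cite: Balaban1988RG2Cluster, p.15] -/
theorem differentiableOn_inv_apply {A : E → Matrix n n ℂ} {s : Set E}
    (hA : ∀ i j, DifferentiableOn ℂ (fun u => A u i j) s) (hdet : ∀ u ∈ s, IsUnit (A u).det) (i j : n) :
    DifferentiableOn ℂ (fun u => (A u)⁻¹ i j) s := by
  have hform : ∀ u, (A u)⁻¹ i j = ((A u).det)⁻¹ * ((A u).updateRow j (Pi.single i 1)).det := by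
    intro u
    rw [Matrix.inv_def, Ring.inverse_eq_inv, Matrix.smul_apply, Matrix.adjugate_apply, smul_eq_mul]
  simp_rw [hform]
  refine DifferentiableOn.mul ((differentiableOn_det hA).inv fun u hu => (hdet u hu).ne_zero)
    (differentiableOn_det fun k l => ?_)
  by_cases hk : k = j
  · subst hk
    simp only [Matrix.updateRow_self]
    exact differentiableOn_const _
  · simp only [Matrix.updateRow_ne hk]
    exact hA k l

/-- **THE SQUARE ROOT (2.7) OF A HOLOMORPHIC ACCRETIVE FAMILY IS HOLOMORPHIC IN THE BACKGROUND** (print p. 15: *"The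
quadratic forms and covariances in H(Z) are analytic functions on the space of configurations (U, J) … with constants
α′₀, α′₁ much bigger than α₀, α₁"* — the analyticity clause `haΓ`∕`haC` of `B13PrimitiveKernels216.differences216_of_analytic`
for the `(C^{(k)})^{1/2}`-factor): if `u ↦ T(u)` is entrywise complex-differentiable on the ball `‖u‖ < R` of a complex
normed configuration space and every `T(u)` there is `m`-accretive with ONE `m > 0`, then every entry of
`u ↦ T(u)^{−1/2}` is complex-differentiable on that ball — holomorphy of dominated parameter integrals
(`Literature.Analysis.Complex.differentiableOn_integral_of_dominated`, majorant `2·kernel m`) and Cramer's rule for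
the resolvent entries. [cite: Balaban1988RG2Cluster, (2.7) p.13, p.15] -/
theorem differentiableOn_invSqrt_apply (T : E → Matrix n n ℂ) {R m : ℝ} (hm : 0 < m)
    (hacc : ∀ u ∈ ball (0 : E) R, ∀ v : n → ℂ, m * ∑ i, ‖v i‖ ^ 2 ≤ (∑ i, star (v i) * (T u *ᵥ v) i).re)
    (hT : ∀ i j, DifferentiableOn ℂ (fun u => T u i j) (ball (0 : E) R)) (i j : n) :
    DifferentiableOn ℂ (fun u => invSqrt (T u) i j) (ball (0 : E) R) := by
  have heq : (fun u => invSqrt (T u) i j) = fun u => (π⁻¹ : ℝ) • ∫ x in Ioi (0 : ℝ),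
      (Real.sqrt x)⁻¹ • ((x : ℂ) • (1 : Matrix n n ℂ) + T u)⁻¹ i j := by
    funext u; rw [invSqrt_apply]
  rw [heq]
  have hint : DifferentiableOn ℂ (fun u => ∫ x in Ioi (0 : ℝ),
      (Real.sqrt x)⁻¹ • ((x : ℂ) • (1 : Matrix n n ℂ) + T u)⁻¹ i j) (ball (0 : E) R) := by
    refine Literature.Analysis.Complex.differentiableOn_integral_of_dominated
      (F := fun u (x : ℝ) => (Real.sqrt x)⁻¹ • ((x : ℂ) • (1 : Matrix n n ℂ) + T u)⁻¹ i j)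
      (fun u hu => aestronglyMeasurable_integrand (T u) hm (hacc u hu) i j) ?_ ?_
    · -- holomorphy of the integrand in the background, for every `x > 0`
      refine ae_restrict_of_forall_mem measurableSet_Ioi fun x hx => ?_
      have hx0 : (0 : ℝ) < x := hx
      have hres : DifferentiableOn ℂ (fun u => ((x : ℂ) • (1 : Matrix n n ℂ) + T u)⁻¹ i j) (ball (0 : E) R) := by
        refine differentiableOn_inv_apply (A := fun u => (x : ℂ) • (1 : Matrix n n ℂ) + T u) (fun k l => ?_)
          (fun u hu => (resolvent_bound_of_accretive (T u) hm (hacc u hu) hx0.le).1) i j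
        simp only [Matrix.add_apply]
        exact (differentiableOn_const _).add (hT k l)
      exact hres.const_smul ((Real.sqrt x)⁻¹)
    · -- the uniform integrable majorant `2·kernel m`
      intro u₀ hu₀
      obtain ⟨ε, hε, hsub⟩ := Metric.isOpen_iff.1 Metric.isOpen_ball u₀ hu₀
      refine ⟨ε, hε, hsub, fun x => 2 * 1 * kernel m x, (integrableOn_kernel_Ioi hm).const_mul (2 * 1), ?_⟩
      refine ae_restrict_of_forall_mem measurableSet_Ioi fun x hx p hp => ?_
      exact norm_integrand_le (fun y hy =>
        ((resolvent_bound_of_accretive (T p) hm (hacc p (hsub hp)) hy).2 i j).trans_eq (mul_one _).symm) hx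
  exact hint.const_smul (π⁻¹ : ℝ)

end Analytic

end Literature.MathematicalPhysics.QuantumFieldTheory.Balaban1983to89.B13Sqrt27Accretive

end
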